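/-
Origin: expansion seat `prover-pub-hodgecm-mc-binder-2-g13-0`, handover #67 2026-08-20T07:14Z md5 59a298ac74b7 (220 l.; 9 s; imports #66; the negative W-reading twin (`R' = ∅`, `z` in the mixed block `P×S`, eigenvalue conjugated): `conjTwo g` (K-1 `map_conj_mem_unitaryGroup`), `map_star_vcMatrix_unitaryOfTwo_conjTwo`, `map_star_vcMatrix_one`, `zArrS`/`wVarsS`/`cover_neg`, `linSubst_letterOfTwoConj_X_zS`, `linSubst_letter_scalar_X_wS`, `…_eq_indScale_neg` ×2, `linSubst_swapTwo_eq_rename_neg`, `rename_planeToDPIdxS_detZ`, **`mem_span_detZ_of_kV_det_eigen_neg [IsEmpty R']`**: eigenvalue `det ((vcMatrix eA A).map star)` ⇒ `G ∈ ℂ ∙ rename (planeToDPIdxS eA eS q₀ R') detZ`; NAME LIST `HodgeCM.Model.HypCensus.mem_span_detZ_of_kV_det_eigen_neg` · `….conjTwo` · `….map_star_vcMatrix_unitaryOfTwo_conjTwo`) (`HOME/mc/pub-hodgecm-mc-binder-2/g13/pkg/HodgeCM/Model/HypCensus/DenseSlotIotaNeg.lean`, md5 59a298ac74b7, 220 l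ines);
landed by the second packager p2 gen 4 (p2-g4) in gate run 44 as `HodgeCM/Model/HypCensus/DenseSlotIotaNeg.lean` (verbatim).
-/
/-
Copyright (c) 2026. All rights reserved.
Released under Apache 2.0 license as described in the file LICENSE.
-/
import Summits.HodgeConjecture.HodgeCM.Model.HypCensus.DenseSlotIota

/-!
# (J-dense), step (iv-b) at the place under `ι₁`, negative `W`-reading: the `det̄`-isotypic Fock polynomials are `ℂ · det z`

Binder-2 lineage, rows 18/19 (`hyp12`/`hyp34`), field `dense` of `HypCoreW`.  The twin of `DenseSlotIota` §3 when the definite plane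
`W` reads NEGATIVE at the place under `ι₁` (`R' = ∅`, `S' ≃ Fin 2` through `eS`): the `z`-variables live in the mixed block `P × S`
(substituted by `conj A`), the `w`-variables in `Q × S`; the eigenvalue of the census is `conj (det (A through eA))`.  Conjugating the
`2 × 2` unitary (`conjTwo`) reduces every computation to the positive reading:

* **`mem_span_detZ_of_kV_det_eigen_neg`**: if every `K_V`-letter `((A, D), (1, 1))` acts on `G` by `det ((vcMatrix eA A)̄)`, then
  `G ∈ ℂ · rename (planeToDPIdxS eA eS q₀ R') det z`.

[KashiwaraVergne1978, Ch. III §5; Adams2007Theta, Prop. 6.6; folklore]  Nothing here is a claim of PerL/QW8.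
-/

noncomputable section

open MvPolynomial Complex
open scoped BigOperators ComplexConjugate
open Literature.Analysis.SegalBargmann

namespace HodgeCM.Model.HypCensus

/-! ## The negative `W`-reading -/

section Neg

open Literature.RepresentationTheory.ClassicalInvariants (map_conj_mem_unitaryGroup)

/-- the entrywise conjugate of a `2 × 2` unitary. -/
def conjTwo (g : Matrix.unitaryGroup (Fin 2) ℂ) : Matrix.unitaryGroup (Fin 2) ℂ :=
  ⟨(g : Matrix (Fin 2) (Fin 2) ℂ).map (starRingEnd ℂ), map_conj_mem_unitaryGroup g⟩

/-- (Ported verbatim from the HodgeCMPerL package; no docstring in the source.) -/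
@[simp] theorem coe_conjTwo_apply (g : Matrix.unitaryGroup (Fin 2) ℂ) (a b : Fin 2) :
    ((conjTwo g : Matrix.unitaryGroup (Fin 2) ℂ) : Matrix (Fin 2) (Fin 2) ℂ) a b = conj ((g : Matrix (Fin 2) (Fin 2) ℂ) a b) := rfl

variable {P' Q' R' S' : Type} [Fintype P'] [DecidableEq P'] [Fintype Q'] [DecidableEq Q'] [Fintype R'] [DecidableEq R']
  [Fintype S'] [DecidableEq S']
variable (eA : Fin 2 ≃ P') (eS : Fin 2 ≃ S') (q₀ : Q')

/-- through the frame and the conjugation: `((vcMatrix eA (g̅ through eA)) conjugated) = g`. -/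
theorem map_star_vcMatrix_unitaryOfTwo_conjTwo (g : Matrix.unitaryGroup (Fin 2) ℂ) :
    (vcMatrix eA ((unitaryOfTwo eA (conjTwo g) : Matrix.unitaryGroup P' ℂ) : Matrix P' P' ℂ)).map star = (g : Matrix (Fin 2) (Fin 2) ℂ) := by
  rw [vcMatrix_unitaryOfTwo]
  ext a b
  rw [Matrix.map_apply, coe_conjTwo_apply, Complex.star_def, Complex.conj_conj]

omit [Fintype P'] in
/-- (Ported verbatim from the HodgeCMPerL package; no docstring in the source.) -/
theorem map_star_vcMatrix_one : (vcMatrix eA (1 : Matrix P' P' ℂ)).map star = (1 : Matrix (Fin 2) (Fin 2) ℂ) := by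
  rw [vcMatrix_one']
  exact Matrix.map_one star (star_zero ℂ) (star_one ℂ)

/-- the array of `z`-variables in the negative reading `z_{aj} = X_{(eA a, eS j)}` (mixed block `P × S`). -/
def zArrS : Fin 2 → Fin 2 → DPIdx P' Q' R' S' := fun a j => Sum.inr (Sum.inl (eA a, eS j))

/-- the `w`-variables in the negative reading: the whole block `Q × S`. -/
def wVarsS : Finset (DPIdx P' Q' R' S') := Finset.univ.image fun qs : Q' × S' => Sum.inl (Sum.inr qs)

omit [DecidableEq P'] [Fintype Q'] [DecidableEq Q'] [DecidableEq S'] [Fintype R'] [DecidableEq R'] [Fintype P'] [Fintype S'] in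
/-- (Ported verbatim from the HodgeCMPerL package; no docstring in the source.) -/
theorem zArrS_injective : Function.Injective fun p : Fin 2 × Fin 2 => zArrS (Q' := Q') (R' := R') eA eS p.1 p.2 := by
  rintro ⟨a, j⟩ ⟨a', j'⟩ h
  simp only [zArrS, Sum.inr.injEq, Sum.inl.injEq, Prod.mk.injEq, eA.injective.eq_iff, eS.injective.eq_iff] at h
  exact Prod.ext h.1 h.2

omit [Fintype R'] [Fintype P'] in
/-- (Ported verbatim from the HodgeCMPerL package; no docstring in the source.) -/
theorem inr_inl_notMem_wVarsS (p : P') (s : S') :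
    (Sum.inr (Sum.inl (p, s)) : DPIdx P' Q' R' S') ∉ wVarsS (P' := P') (Q' := Q') (R' := R') (S' := S') := by
  simp [wVarsS]

omit [Fintype R'] [Fintype P'] in
/-- (Ported verbatim from the HodgeCMPerL package; no docstring in the source.) -/
theorem zArrS_notMem_wVarsS (a j : Fin 2) : zArrS eA eS a j ∉ wVarsS (P' := P') (Q' := Q') (R' := R') (S' := S') :=
  inr_inl_notMem_wVarsS _ _

omit [Fintype Q'] [Fintype S'] [Fintype P'] [Fintype R'] in
/-- (Ported verbatim from the HodgeCMPerL package; no docstring in the source.) -/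
theorem mem_rowVars_zArrS_iff (a b : Fin 2) (j : Fin 2) : zArrS (Q' := Q') (R' := R') eA eS b j ∈ rowVars (zArrS eA eS) a ↔ b = a := by
  constructor
  · intro h
    obtain ⟨j', _, hj'⟩ := Finset.mem_image.mp h
    have := zArrS_injective eA eS (a₁ := (a, j')) (a₂ := (b, j)) hj'
    exact ((Prod.mk.inj this).1).symm
  · rintro rfl; exact mem_rowVars b j

omit [Fintype Q'] [Fintype S'] [Fintype P'] [Fintype R'] in
/-- (Ported verbatim from the HodgeCMPerL package; no docstring in the source.) -/
theorem inl_inr_notMem_rowVars (a : Fin 2) (q : Q') (s : S') :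
    (Sum.inl (Sum.inr (q, s)) : DPIdx P' Q' R' S') ∉ rowVars (zArrS eA eS) a := by
  intro h
  obtain ⟨j', _, hj'⟩ := Finset.mem_image.mp h
  exact Sum.inr_ne_inl hj'

omit [Fintype R'] [Fintype P'] in
/-- every variable of the negatively read `ι₁` slot is a `z`- or a `w`-variable. -/
theorem cover_neg [IsEmpty R'] (i : DPIdx P' Q' R' S') :
    i ∈ rowVars (zArrS eA eS) 0 ∨ i ∈ rowVars (zArrS eA eS) 1 ∨ i ∈ wVarsS (P' := P') (Q' := Q') (R' := R') (S' := S') := by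
  rcases i with (⟨p, r⟩ | ⟨q, s⟩) | (⟨p, s⟩ | ⟨q, r⟩)
  · exact isEmptyElim r
  · exact Or.inr (Or.inr (Finset.mem_image.mpr ⟨(q, s), Finset.mem_univ _, rfl⟩))
  · obtain ⟨a, rfl⟩ := eA.surjective p
    obtain ⟨j, rfl⟩ := eS.surjective s
    fin_cases a
    · exact Or.inl (mem_rowVars (x := zArrS eA eS) 0 j)
    · exact Or.inr (Or.inl (mem_rowVars (x := zArrS eA eS) 1 j))
  · exact isEmptyElim r

/-- the letter `((g̅ through eA, D), (1,1))` on a `z`-variable of the negative reading: `z_{aj} ↦ Σ_b g_{ab} z_{bj}`. -/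
theorem linSubst_letterOfTwoConj_X_zS (g : Matrix.unitaryGroup (Fin 2) ℂ) (D : Matrix.unitaryGroup Q' ℂ) (a j : Fin 2) :
    linSubst (star ((dualPairι (((unitaryOfTwo eA (conjTwo g), D), (1, 1)) : DPK P' Q' R' S') :
        Matrix.unitaryGroup (DPIdx P' Q' R' S') ℂ) : Matrix (DPIdx P' Q' R' S') (DPIdx P' Q' R' S') ℂ)) (X (zArrS eA eS a j)) =
      ∑ b : Fin 2, C ((g : Matrix (Fin 2) (Fin 2) ℂ) a b) * X (zArrS eA eS b j) := by
  rw [zArrS, linSubst_star_dualPairι_kV_X_inr_inl, ← eA.sum_comp]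
  simp only [coe_unitaryOfTwo_apply, Equiv.symm_apply_apply, coe_conjTwo_apply, Complex.star_def, Complex.conj_conj, zArrS]

/-- the letter `((A, t·1), (1,1))` on a `w`-variable of the negative reading: `X_{(q,s)} ↦ t · X_{(q,s)}`. -/
theorem linSubst_letter_scalar_X_wS (A : Matrix.unitaryGroup P' ℂ) (t : Circle) (q : Q') (s : S') :
    linSubst (star ((dualPairι (((A, circleScalarUnitary Q' t), (1, 1)) : DPK P' Q' R' S') : Matrix.unitaryGroup (DPIdx P' Q' R' S') ℂ) :
        Matrix (DPIdx P' Q' R' S') (DPIdx P' Q' R' S') ℂ)) (X (Sum.inl (Sum.inr (q, s)))) =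
      C (t : ℂ) * X (Sum.inl (Sum.inr (q, s))) := by
  rw [linSubst_star_dualPairι_X_QS_general]
  simp only [coe_circleScalarUnitary, OneMemClass.coe_one, Matrix.smul_apply, Matrix.one_apply, smul_eq_mul, mul_ite,
    mul_one, mul_zero, ite_mul, zero_mul, apply_ite C, map_zero, Finset.sum_ite_eq', Finset.mem_univ, if_true]

/-- the conjugated row-circle letter IS the circle scaling of the row variables (negative reading). -/
theorem linSubst_rowCircle_eq_indScale_neg [IsEmpty R'] (a : Fin 2) (t : Circle) :
    linSubst (star ((dualPairι (((unitaryOfTwo eA (conjTwo (rowCircle a t)), (1 : Matrix.unitaryGroup Q' ℂ)), (1, 1)) : DPK P' Q' R' S') :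
        Matrix.unitaryGroup (DPIdx P' Q' R' S') ℂ) : Matrix (DPIdx P' Q' R' S') (DPIdx P' Q' R' S') ℂ)) =
      linSubst (indScale (rowVars (zArrS eA eS) a) (t : ℂ)) := by
  refine MvPolynomial.algHom_ext fun i => ?_
  rcases i with (⟨p, r⟩ | ⟨q, s⟩) | (⟨p, s⟩ | ⟨q, r⟩)
  · exact isEmptyElim r
  · have h1 : (1 : Matrix.unitaryGroup Q' ℂ) = circleScalarUnitary Q' 1 :=
      Subtype.ext (by rw [coe_circleScalarUnitary, Circle.coe_one, one_smul]; rfl)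
    rw [h1, linSubst_letter_scalar_X_wS, linSubst_indScale_X, if_neg (inl_inr_notMem_rowVars eA eS a q s), Circle.coe_one]
  · obtain ⟨b, rfl⟩ := eA.surjective p
    obtain ⟨j, rfl⟩ := eS.surjective s
    rw [show (Sum.inr (Sum.inl (eA b, eS j)) : DPIdx P' Q' R' S') = zArrS eA eS b j from rfl, linSubst_letterOfTwoConj_X_zS,
      linSubst_indScale_X, Fin.sum_univ_two]
    simp only [mem_rowVars_zArrS_iff, coe_rowCircle]
    fin_cases a <;> fin_cases b <;> simp [Matrix.diagonal]
  · exact isEmptyElim r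

/-- the scalar-`D` letter IS the circle scaling of the `w`-variables (negative reading). -/
theorem linSubst_scalarD_eq_indScale_neg [IsEmpty R'] (t : Circle) :
    linSubst (star ((dualPairι ((((1 : Matrix.unitaryGroup P' ℂ), circleScalarUnitary Q' t), (1, 1)) : DPK P' Q' R' S') :
        Matrix.unitaryGroup (DPIdx P' Q' R' S') ℂ) : Matrix (DPIdx P' Q' R' S') (DPIdx P' Q' R' S') ℂ)) =
      linSubst (indScale (wVarsS (P' := P') (Q' := Q') (R' := R') (S' := S')) (t : ℂ)) := by
  refine MvPolynomial.algHom_ext fun i => ?_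
  rcases i with (⟨p, r⟩ | ⟨q, s⟩) | (⟨p, s⟩ | ⟨q, r⟩)
  · exact isEmptyElim r
  · have hm : (Sum.inl (Sum.inr (q, s)) : DPIdx P' Q' R' S') ∈ wVarsS (P' := P') (Q' := Q') (R' := R') (S' := S') :=
      Finset.mem_image.mpr ⟨(q, s), Finset.mem_univ _, rfl⟩
    rw [linSubst_letter_scalar_X_wS, linSubst_indScale_X, if_pos hm]
  · rw [linSubst_star_dualPairι_X_inr_inl, linSubst_indScale_X,
      if_neg (inr_inl_notMem_wVarsS (P' := P') (Q' := Q') (R' := R') (S' := S') p s), map_one, one_mul]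
    simp only [OneMemClass.coe_one, Matrix.one_apply, apply_ite star, star_one, star_zero, mul_ite, mul_one, mul_zero, apply_ite C,
      map_one, map_zero, ite_mul, one_mul, zero_mul, Finset.sum_ite_eq', Finset.mem_univ, if_true]
  · exact isEmptyElim r

/-- the (conjugated) swap letter IS the renaming by the row swap (negative reading). -/
theorem linSubst_swapTwo_eq_rename_neg [IsEmpty R'] :
    linSubst (star ((dualPairι (((unitaryOfTwo eA (conjTwo swapTwo), (1 : Matrix.unitaryGroup Q' ℂ)), (1, 1)) : DPK P' Q' R' S') :
        Matrix.unitaryGroup (DPIdx P' Q' R' S') ℂ) : Matrix (DPIdx P' Q' R' S') (DPIdx P' Q' R' S') ℂ)) =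
      (rename (rowSwap (zArrS (Q' := Q') (R' := R') eA eS)) :
        MvPolynomial (DPIdx P' Q' R' S') ℂ →ₐ[ℂ] MvPolynomial (DPIdx P' Q' R' S') ℂ) := by
  refine MvPolynomial.algHom_ext fun i => ?_
  rcases i with (⟨p, r⟩ | ⟨q, s⟩) | (⟨p, s⟩ | ⟨q, r⟩)
  · exact isEmptyElim r
  · have h1 : (1 : Matrix.unitaryGroup Q' ℂ) = circleScalarUnitary Q' 1 :=
      Subtype.ext (by rw [coe_circleScalarUnitary, Circle.coe_one, one_smul]; rfl)
    rw [h1, linSubst_letter_scalar_X_wS, rename_X, rowSwap_apply_of_notMem (inl_inr_notMem_rowVars eA eS 0 q s)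
      (inl_inr_notMem_rowVars eA eS 1 q s), Circle.coe_one, map_one, one_mul]
  · obtain ⟨b, rfl⟩ := eA.surjective p
    obtain ⟨j, rfl⟩ := eS.surjective s
    rw [show (Sum.inr (Sum.inl (eA b, eS j)) : DPIdx P' Q' R' S') = zArrS eA eS b j from rfl, linSubst_letterOfTwoConj_X_zS, rename_X,
      Fin.sum_univ_two]
    fin_cases b
    · rw [show zArrS (Q' := Q') (R' := R') eA eS ((fun i => i) ⟨0, by decide⟩) j = zArrS eA eS 0 j from rfl,
        rowSwap_apply_row0 (zArrS_injective eA eS)]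
      simp [swapTwo_apply]
    · rw [show zArrS (Q' := Q') (R' := R') eA eS ((fun i => i) ⟨1, by decide⟩) j = zArrS eA eS 1 j from rfl,
        rowSwap_apply_row1 (zArrS_injective eA eS)]
      simp [swapTwo_apply]
  · exact isEmptyElim r

omit [Fintype P'] [DecidableEq P'] [Fintype Q'] [DecidableEq Q'] [Fintype R'] [DecidableEq R'] [Fintype S'] [DecidableEq S'] in
/-- the printed line renames to `det2` of the array (negative reading). -/
theorem rename_planeToDPIdxS_detZ :
    rename (planeToDPIdxS eA eS q₀ R') HodgeCM.PerL34.Fock.detZ = det2 (zArrS (Q' := Q') (R' := R') eA eS) := by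
  simp only [HodgeCM.PerL34.Fock.detZ, HodgeCM.PerL34.Fock.z, map_sub, map_mul, rename_X, planeToDPIdxS_z, det2, zArrS]

/-- **THE `det`-ISOTYPIC FOCK POLYNOMIALS OF THE `ι₁` SLOT ARE `ℂ · det z`** (negative `W`-reading: `R' = ∅`, `S' ≃ Fin 2`):
if every `K_V`-letter `((A, D), (1, 1))` acts on `G` by `conj (det (A read through eA))`, then `G ∈ ℂ · rename (planeToDPIdxS eA eS q₀ R') det z`.
[KashiwaraVergne1978, Ch. III §5; Adams2007Theta, Prop. 6.6] -/
theorem mem_span_detZ_of_kV_det_eigen_neg [IsEmpty R'] (G : MvPolynomial (DPIdx P' Q' R' S') ℂ)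
    (h : ∀ (A : Matrix.unitaryGroup P' ℂ) (D : Matrix.unitaryGroup Q' ℂ),
      linSubst (star ((dualPairι (((A, D), (1, 1)) : DPK P' Q' R' S') : Matrix.unitaryGroup (DPIdx P' Q' R' S') ℂ) :
          Matrix (DPIdx P' Q' R' S') (DPIdx P' Q' R' S') ℂ)) G = ((vcMatrix eA (A : Matrix P' P' ℂ)).map star).det • G) :
    G ∈ Submodule.span ℂ ({rename (planeToDPIdxS eA eS q₀ R') HodgeCM.PerL34.Fock.detZ} : Set (MvPolynomial (DPIdx P' Q' R' S') ℂ)) := by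
  rw [rename_planeToDPIdxS_detZ]
  refine mem_span_det2_of_circles_swap (zArrS eA eS) (zArrS_injective eA eS) wVarsS (zArrS_notMem_wVarsS eA eS) (cover_neg eA eS)
    (fun u hu => ?_) (fun u hu => ?_) (fun u hu => ?_) ?_
  · have := h (unitaryOfTwo eA (conjTwo (rowCircle 0 (circleOfNorm u hu)))) 1
    rwa [map_star_vcMatrix_unitaryOfTwo_conjTwo, det_rowCircle, coe_circleOfNorm, linSubst_rowCircle_eq_indScale_neg,
      coe_circleOfNorm] at this
  · have := h (unitaryOfTwo eA (conjTwo (rowCircle 1 (circleOfNorm u hu)))) 1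
    rwa [map_star_vcMatrix_unitaryOfTwo_conjTwo, det_rowCircle, coe_circleOfNorm, linSubst_rowCircle_eq_indScale_neg,
      coe_circleOfNorm] at this
  · have := h 1 (circleScalarUnitary Q' (circleOfNorm u hu))
    rwa [OneMemClass.coe_one, map_star_vcMatrix_one, Matrix.det_one, one_smul, linSubst_scalarD_eq_indScale_neg, coe_circleOfNorm] at this
  · have := h (unitaryOfTwo eA (conjTwo swapTwo)) 1
    rwa [map_star_vcMatrix_unitaryOfTwo_conjTwo, det_swapTwo, linSubst_swapTwo_eq_rename_neg, neg_one_smul] at this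

end Neg

end HodgeCM.Model.HypCensus

end
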